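import Summits.BirchSwinnertonDyer.Rank1Residual.P2.CongruentNumberSilentEvenFiveEnclosureSplit
import Literature.NumberTheory.EllipticCurves.Tian2014.CMPointSystemBridgeDisplays
import HarnessLib

/-!
# Cell «bsd-monsky» (typer): THE ENCLOSURE RELATIVE TO THE BRIDGED SYSTEM FACT — C-P2-1 from `hMe` (or `h515`) and
# `tian2014_system_sMinus_bridged` (Tian Thm. 2.8 system ∧ TYZ Thm. 3.3 at `χ₀` ∧ TYZ p. 749 through `ϕ` ∧ the point
# identification (8.1.4) — the single remaining flagged sentence — ∧ Gauss genus theory)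

HONEST FRAMING: nothing asserted; conditional on the displayed fact `hSys‴` (`Tian2014.tian2014_system_sMinus_bridged`)
and on `hMe` (Heath-Brown 1994, Appendix (Monsky), even case, printed as a sketch proof, pp. 368–369; a named fact)
resp. `h515` (Monsky 1990 Cor. 5.15 with Remark (2)). Compared with the split form (`…EnclosureSplit.lean`, p405092),
the bridge «`R_{χ₀} = ±2y + torsion`» (PROOF-A Lemma 8.1) is no longer displayed: it is the kernel theorem
`CMPointData.bridgeLemma81_of_bridgeDisplays` of (B1) TYZ p. 749 (printed) and (B2) the point identification
`CMPointData.tianPointIdentification` («`z = u·ϕ(z_N) + t₀ + (1+√2, 2+√2)`», PROOF-A (8.1.4)), on which the (B4) flag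
now sits alone. One-line compositions; nothing booked.
-/

noncomputable section

open scoped Classical

open Literature.NumberTheory.EllipticCurves.Monsky1990

set_option autoImplicit false

namespace Summit.BirchSwinnertonDyer.Rank1Residual.P2

open Conjectures Literature.NumberTheory.EllipticCurves.Tian2014
  Literature.NumberTheory.EllipticCurves.HeathBrown1994

/-- **C-P2-1 relative to Heath-Brown 1994's Selmer count and the BRIDGED system fact** (no Cor 5.15). Sorry-free;
nothing asserted. [cite: HeathBrown1994SelmerCongruentII, Appendix (Monsky)] [cite: Tian2014, Thm. 2.8 (J132), Notations (J122–123)]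
[cite: TianYuanZhang2017, Thm. 3.3 (p. 739), p. 749] [cite: Miller2011LMS, Def. 1.1] -/
theorem congruentSilentEvenFiveBSDTwo_of_bridgedSystem_of_monskyEven (hMe : monsky_card_selmerGroup_two_even)
    (hSys : tian2014_system_sMinus_bridged) : CongruentSilentEvenFiveBSDTwo :=
  congruentSilentEvenFiveBSDTwo_of_splitSystem_of_monskyEven hMe (tian2014_system_sMinus_split_of_bridged hSys)

/-- **C-P2-1 relative to Monsky 1990 Cor. 5.15 and the BRIDGED system fact.** Sorry-free; nothing asserted.
[cite: Monsky1990MockHeegner, Cor. 5.15 (p. 66), Remark (2) (p. 67)] [cite: Tian2014, Thm. 2.8 (J132), Notations (J122–123)]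
[cite: TianYuanZhang2017, Thm. 3.3 (p. 739), p. 749] [cite: Miller2011LMS, Def. 1.1] -/
theorem congruentSilentEvenFiveBSDTwo_of_bridgedSystem
    (h515 : cor515_rank_eq_one_and_card_selmerGroup_two) (hSys : tian2014_system_sMinus_bridged) :
    CongruentSilentEvenFiveBSDTwo :=
  congruentSilentEvenFiveBSDTwo_of_splitSystem h515 (tian2014_system_sMinus_split_of_bridged hSys)

end Summit.BirchSwinnertonDyer.Rank1Residual.P2

end
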